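import Mathlib

/-!
# Prömel–Rödl core from the DRC step

Helper file for the crux `Summit.PneNP.PneNP.Theses.RamseyUncertifiable.ResolutionUncertainty`
(item stmt-PneNP-9816), line `box-dag-self-gadget-lifting`, registered stub `stub_promelRodl`
(`DRCStep → PRCore` in the lead skeleton).

Content: the Prömel–Rödl (1999) / Lauria–Pudlák–Rödl–Thapen (arXiv:1303.3166, Lemma 11) core lemma at
the Erdős threshold, in disjoint-pair form, *derived from* the one-sided dependent-random-choice step
(the neighbouring stub `stub_drcStep`, which is the hypothesis here): every graph `G` on `n ≥ n₀`
vertices such that neither `G` nor `Gᶜ` has a clique of size `⌈log₂ n²⌉` contains a vertex set `S`,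
`|S| ≥ n^{3/4}`, inside which both `G` and `Gᶜ` have edge density `≥ δ` between any two disjoint sets
of size `≥ |S|^{1-β}` (`β = 1/2000`, `δ = δ₀/2` where `δ₀` is the DRC constant at `κ = 1/2000`).

Proof: run a recursion on states `(T, Jind, Jclq)` — `Jind` an independent set complete to `T` in
`Gᶜ`, `Jclq` a clique complete to `T` in `G` — starting from `(univ, ∅, ∅)`.  If `T` is not yet good, a
bad disjoint pair `A, B ⊆ T` is sparse in `G` or in `Gᶜ`; Markov plus the DRC step (for `G`, resp.
`Gᶜ`) grows `Jind` (resp. `Jclq`) by `≥ log₂ n / 40` vertices while `|T|` drops from `n^e` to at least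
`n^{e - 1/1000}`.  Since `|Jind|, |Jclq| < ⌈log₂ n²⌉ ≤ 2 log₂ n + 1`, a good `T` with `|T| ≥ n^{0.84}`
appears within `161` levels.  Only Mathlib is used.
-/

-- the helper-file namespace `Summit.PneNP.PneNP.Theorems.…` is prescribed by the tree layout
set_option linter.dupNamespace false

namespace Summit.PneNP.PneNP.Theorems.RamseyUncertifiableResolutionUncertainty

open Finset Real

/-- The number of ordered edges of `H` from `A` to `B` is the sum over `v ∈ A` of the degree of `v`
into `B`. -/
private theorem card_interedges_eq_sum_card_filter {V : Type*} (H : SimpleGraph V)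
    [DecidableRel H.Adj] (A B : Finset V) :
    #(H.interedges A B) = ∑ v ∈ A, #(B.filter fun b => H.Adj v b) := by
  rw [SimpleGraph.interedges_def, Finset.card_filter, Finset.sum_product]
  refine Finset.sum_congr rfl fun x _ => ?_
  rw [Finset.card_filter]

/-- Markov: if `d_H(A,B) < δ₀/2` (with `A`, `B` nonempty) then at least half of the vertices of `A`
have at most `δ₀ |B|` neighbours in `B`. -/
private theorem card_le_two_mul_card_filter {V : Type*} (H : SimpleGraph V) [DecidableRel H.Adj]
    {A B : Finset V} {δ₀ : ℝ} (hδ₀ : 0 < δ₀) (hB : 0 < #B)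
    (hd : (H.edgeDensity A B : ℝ) < δ₀ / 2) :
    (#A : ℝ) ≤ 2 * #(A.filter fun v => (#(B.filter fun b => H.Adj v b) : ℝ) ≤ δ₀ * #B) := by
  rcases Nat.eq_zero_or_pos #A with hA | hA
  · rw [hA, Nat.cast_zero]; positivity
  have hA' : (0 : ℝ) < #A := by exact_mod_cast hA
  have hB' : (0 : ℝ) < #B := by exact_mod_cast hB
  rw [SimpleGraph.edgeDensity_def] at hd
  push_cast at hd
  rw [div_lt_iff₀ (by positivity), card_interedges_eq_sum_card_filter] at hd
  push_cast at hd
  rw [← Finset.sum_filter_add_sum_filter_not A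
    (fun v => (#(B.filter fun b => H.Adj v b) : ℝ) ≤ δ₀ * #B)] at hd
  have h1 : (#(A.filter fun v => ¬ ((#(B.filter fun b => H.Adj v b) : ℝ) ≤ δ₀ * #B)) : ℝ) *
      (δ₀ * #B) ≤ ∑ v ∈ A.filter (fun v => ¬ ((#(B.filter fun b => H.Adj v b) : ℝ) ≤ δ₀ * #B)),
        (#(B.filter fun b => H.Adj v b) : ℝ) := by
    rw [← nsmul_eq_mul]
    exact Finset.card_nsmul_le_sum _ _ _ fun v hv => le_of_lt (not_le.1 (Finset.mem_filter.1 hv).2)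
  have h2 : (0 : ℝ) ≤ ∑ v ∈ A.filter (fun v => (#(B.filter fun b => H.Adj v b) : ℝ) ≤ δ₀ * #B),
      (#(B.filter fun b => H.Adj v b) : ℝ) := Finset.sum_nonneg fun _ _ => by positivity
  have h3 := Finset.card_filter_add_card_filter_not (s := A)
    (fun v => (#(B.filter fun b => H.Adj v b) : ℝ) ≤ δ₀ * #B)
  have h4 : (#(A.filter fun v => (#(B.filter fun b => H.Adj v b) : ℝ) ≤ δ₀ * #B) : ℝ) +
      #(A.filter fun v => ¬ ((#(B.filter fun b => H.Adj v b) : ℝ) ≤ δ₀ * #B)) = #A := by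
    exact_mod_cast h3
  have h5 : (#(A.filter fun v => ¬ ((#(B.filter fun b => H.Adj v b) : ℝ) ≤ δ₀ * #B)) : ℝ) *
      (δ₀ * #B) < #A / 2 * (δ₀ * #B) := by linarith
  have h6 := lt_of_mul_lt_mul_right h5 (by positivity)
  linarith

/-- A clique of a `K_k`-free graph has fewer than `k` vertices. -/
private theorem card_lt_of_cliqueFree {V : Type*} {H : SimpleGraph V} {k : ℕ} {J : Finset V}
    (hH : H.CliqueFree k) (hJ : H.IsClique (J : Set V)) : #J < k := by
  by_contra! h
  obtain ⟨t, htJ, ht⟩ := Finset.exists_subset_card_eq h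
  exact hH t ⟨hJ.subset (Finset.coe_subset.2 htJ), ht⟩

/-- `2 ≤ n^{1/4}` once `n ≥ 16`. -/
private theorem two_le_rpow_quarter {n : ℕ} (hn : 16 ≤ n) : (2 : ℝ) ≤ (n : ℝ) ^ ((1 : ℝ) / 4) := by
  have h16 : (16 : ℝ) ≤ n := by exact_mod_cast hn
  calc (2 : ℝ) = (16 : ℝ) ^ ((1 : ℝ) / 4) := by
        rw [show (16 : ℝ) = 2 ^ (4 : ℝ) by norm_num, ← Real.rpow_mul (by norm_num)]; norm_num
    _ ≤ (n : ℝ) ^ ((1 : ℝ) / 4) := Real.rpow_le_rpow (by norm_num) h16 (by norm_num)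

/-- Exponent bookkeeping of one level of the recursion: from `|T| ≥ n^{1 - i/1000}` (`i ≤ 160`,
`n ≥ 16`) we get `|T| ≥ n^{3/4}`, and every `A` with `|A| ≥ |T|^{1-β}` has `|A| ≥ 2√n`, is nonempty,
and `|A| n^{-κ} ≥ n^{1 - (i+1)/1000}` (`β = κ = 1/2000`). -/
private theorem sizes {n i : ℕ} (hn : 16 ≤ n) (hi : i ≤ 160) {T : Finset (Fin n)}
    (hT : (n : ℝ) ^ (1 - (i : ℝ) / 1000) ≤ #T) :
    (n : ℝ) ^ ((3 : ℝ) / 4) ≤ #T ∧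
    ∀ A : Finset (Fin n), (#T : ℝ) ^ (1 - 1 / 2000 : ℝ) ≤ #A →
      2 * (n : ℝ) ^ ((1 : ℝ) / 2) ≤ #A ∧ 0 < #A ∧
      ∀ T' : Finset (Fin n), (#A : ℝ) * (n : ℝ) ^ (-(1 / 2000 : ℝ)) ≤ #T' →
        (n : ℝ) ^ (1 - ((i + 1 : ℕ) : ℝ) / 1000) ≤ #T' := by
  have hn1 : (1 : ℝ) ≤ n := by exact_mod_cast le_trans (by norm_num) hn
  have hn0 : (0 : ℝ) < n := by linarith
  have hi' : (i : ℝ) ≤ 160 := by exact_mod_cast hi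
  have hi0 : (0 : ℝ) ≤ i := Nat.cast_nonneg i
  have h34 : (n : ℝ) ^ ((3 : ℝ) / 4) ≤ (n : ℝ) ^ (1 - (i : ℝ) / 1000) :=
    Real.rpow_le_rpow_of_exponent_le hn1 (by linarith)
  refine ⟨h34.trans hT, fun A hA => ?_⟩
  have hne : (0 : ℝ) ≤ (n : ℝ) ^ (1 - (i : ℝ) / 1000) := Real.rpow_nonneg hn0.le _
  have hA' : (n : ℝ) ^ ((1 - (i : ℝ) / 1000) * (1 - 1 / 2000)) ≤ #A := by
    rw [Real.rpow_mul hn0.le]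
    exact (Real.rpow_le_rpow hne hT (by norm_num)).trans hA
  have h34' : (n : ℝ) ^ ((3 : ℝ) / 4) ≤ #A :=
    (Real.rpow_le_rpow_of_exponent_le hn1 (by linarith)).trans hA'
  have hsplit : (n : ℝ) ^ ((3 : ℝ) / 4) = (n : ℝ) ^ ((1 : ℝ) / 2) * (n : ℝ) ^ ((1 : ℝ) / 4) := by
    rw [← Real.rpow_add hn0]; norm_num
  have hq := two_le_rpow_quarter hn
  have hhalf : (0 : ℝ) < (n : ℝ) ^ ((1 : ℝ) / 2) := Real.rpow_pos_of_pos hn0 _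
  have hprod := mul_le_mul_of_nonneg_left hq hhalf.le
  have hApos : (0 : ℝ) < #A := by linarith
  refine ⟨by linarith, by exact_mod_cast hApos, fun T' hT' => ?_⟩
  calc (n : ℝ) ^ (1 - ((i + 1 : ℕ) : ℝ) / 1000)
      ≤ (n : ℝ) ^ ((1 - (i : ℝ) / 1000) * (1 - 1 / 2000) + -(1 / 2000 : ℝ)) :=
        Real.rpow_le_rpow_of_exponent_le hn1 (by push_cast; linarith)
    _ = (n : ℝ) ^ ((1 - (i : ℝ) / 1000) * (1 - 1 / 2000)) * (n : ℝ) ^ (-(1 / 2000 : ℝ)) :=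
        Real.rpow_add hn0 _ _
    _ ≤ #A * (n : ℝ) ^ (-(1 / 2000 : ℝ)) := by gcongr
    _ ≤ #T' := hT'

/-- One level of the recursion for a graph `H` with the DRC property: a disjoint pair `A, B ⊆ T`,
`|A| ≥ 2√n`, `B ≠ ∅`, which is sparse in `H` (`d_H(A,B) < δ₀/2`) lets us grow the `Hᶜ`-clique `Jind`
(complete to `T` in `Hᶜ`) by `≥ log₂ n / 40` vertices of `A`, replacing `T` by a set `T' ⊆ B` with
`|T'| ≥ |B| n^{-κ}`; the `H`-clique `Jclq` complete to `T` in `H` is kept. -/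
private theorem step {n : ℕ} (H : SimpleGraph (Fin n)) [DecidableRel H.Adj] {κ δ₀ : ℝ} (hδ₀ : 0 < δ₀)
    (hDRC : ∀ A B : Finset (Fin n), (n : ℝ) ^ ((1 : ℝ) / 2) ≤ A.card →
      (∀ v ∈ A, ((B.filter fun b => H.Adj v b).card : ℝ) ≤ δ₀ * B.card) →
      ∃ J ⊆ A, Hᶜ.IsClique (J : Set (Fin n)) ∧ Real.logb 2 n / 40 ≤ J.card ∧
        (B.card : ℝ) * (n : ℝ) ^ (-κ) ≤ ((B.filter fun b => ∀ v ∈ J, ¬ H.Adj v b).card : ℝ))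
    {T Jind Jclq A B : Finset (Fin n)}
    (hJind : Hᶜ.IsClique (Jind : Set (Fin n)) ∧ ∀ u ∈ Jind, ∀ t ∈ T, Hᶜ.Adj u t)
    (hJclq : H.IsClique (Jclq : Set (Fin n)) ∧ ∀ u ∈ Jclq, ∀ t ∈ T, H.Adj u t)
    (hAT : A ⊆ T) (hBT : B ⊆ T) (hAB : Disjoint A B)
    (hA : 2 * (n : ℝ) ^ ((1 : ℝ) / 2) ≤ A.card) (hB : 0 < B.card)
    (hd : (H.edgeDensity A B : ℝ) < δ₀ / 2) :
    ∃ T' Jind' : Finset (Fin n), T' ⊆ T ∧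
      (Hᶜ.IsClique (Jind' : Set (Fin n)) ∧ ∀ u ∈ Jind', ∀ t ∈ T', Hᶜ.Adj u t) ∧
      (H.IsClique (Jclq : Set (Fin n)) ∧ ∀ u ∈ Jclq, ∀ t ∈ T', H.Adj u t) ∧
      (B.card : ℝ) * (n : ℝ) ^ (-κ) ≤ T'.card ∧
      (Jind.card : ℝ) + Real.logb 2 n / 40 ≤ Jind'.card := by
  have hM := card_le_two_mul_card_filter H hδ₀ hB hd
  have hA₁A : (A.filter fun v => ((B.filter fun b => H.Adj v b).card : ℝ) ≤ δ₀ * B.card) ⊆ A :=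
    Finset.filter_subset _ _
  obtain ⟨J, hJA₁, hJcl, hJcard, hT'⟩ :=
    hDRC (A.filter fun v => ((B.filter fun b => H.Adj v b).card : ℝ) ≤ δ₀ * B.card) B
      (by linarith) fun v hv => (Finset.mem_filter.1 hv).2
  have hJA : J ⊆ A := hJA₁.trans hA₁A
  have hT'B : (B.filter fun b => ∀ v ∈ J, ¬ H.Adj v b) ⊆ B := Finset.filter_subset _ _
  have hJT' : ∀ u ∈ J, ∀ t ∈ (B.filter fun b => ∀ v ∈ J, ¬ H.Adj v b), Hᶜ.Adj u t := by
    intro u hu t ht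
    rw [SimpleGraph.compl_adj]
    exact ⟨fun h => Finset.disjoint_left.1 hAB (hJA hu) (h ▸ hT'B ht),
      (Finset.mem_filter.1 ht).2 u hu⟩
  have hdisj : Disjoint Jind J :=
    Finset.disjoint_left.2 fun u hu huJ => (hJind.2 u hu u (hAT (hJA huJ))).ne rfl
  refine ⟨(B.filter fun b => ∀ v ∈ J, ¬ H.Adj v b), Jind ∪ J, hT'B.trans hBT, ⟨?_, ?_⟩,
    ⟨hJclq.1, fun u hu t ht => hJclq.2 u hu t (hBT (hT'B ht))⟩, hT', ?_⟩
  · rw [SimpleGraph.isClique_iff, Finset.coe_union, Set.pairwise_union]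
    exact ⟨hJind.1, hJcl, fun a ha b hb _ =>
      ⟨hJind.2 a ha b (hAT (hJA hb)), (hJind.2 a ha b (hAT (hJA hb))).symm⟩⟩
  · intro u hu t ht
    rcases Finset.mem_union.1 hu with hu | hu
    · exact hJind.2 u hu t (hBT (hT'B ht))
    · exact hJT' u hu t ht
  · rw [Finset.card_union_of_disjoint hdisj]
    push_cast
    linarith

/-- The recursion, as an induction on the level `i ≤ 161`: either a good set `S` with `|S| ≥ n^{3/4}`
has been found, or there is a state `(T, Jind, Jclq)` with `|T| ≥ n^{1 - i/1000}` and
`|Jind| + |Jclq| ≥ i log₂ n / 40`. -/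
private theorem iterate {n : ℕ} (G : SimpleGraph (Fin n)) [DecidableRel G.Adj] {δ₀ : ℝ} (hδ₀ : 0 < δ₀)
    (hn : 16 ≤ n)
    (hDRC : ∀ (H : SimpleGraph (Fin n)) [DecidableRel H.Adj], H.CliqueFree (Nat.clog 2 (n ^ 2)) →
      ∀ A B : Finset (Fin n), (n : ℝ) ^ ((1 : ℝ) / 2) ≤ A.card →
        (∀ v ∈ A, ((B.filter fun b => H.Adj v b).card : ℝ) ≤ δ₀ * B.card) →
        ∃ J ⊆ A, Hᶜ.IsClique (J : Set (Fin n)) ∧ Real.logb 2 n / 40 ≤ J.card ∧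
          (B.card : ℝ) * (n : ℝ) ^ (-(1 / 2000 : ℝ)) ≤
            ((B.filter fun b => ∀ v ∈ J, ¬ H.Adj v b).card : ℝ))
    (hG : G.CliqueFree (Nat.clog 2 (n ^ 2))) (hGc : Gᶜ.CliqueFree (Nat.clog 2 (n ^ 2)))
    (i : ℕ) (hi : i ≤ 161) :
    (∃ S : Finset (Fin n), (n : ℝ) ^ ((3 : ℝ) / 4) ≤ S.card ∧
      ∀ A ⊆ S, ∀ B ⊆ S, Disjoint A B →
        (S.card : ℝ) ^ (1 - 1 / 2000 : ℝ) ≤ A.card → (S.card : ℝ) ^ (1 - 1 / 2000 : ℝ) ≤ B.card →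
        δ₀ / 2 ≤ (G.edgeDensity A B : ℝ) ∧ δ₀ / 2 ≤ (Gᶜ.edgeDensity A B : ℝ)) ∨
    ∃ T Jind Jclq : Finset (Fin n),
      (Gᶜ.IsClique (Jind : Set (Fin n)) ∧ ∀ u ∈ Jind, ∀ t ∈ T, Gᶜ.Adj u t) ∧
      (G.IsClique (Jclq : Set (Fin n)) ∧ ∀ u ∈ Jclq, ∀ t ∈ T, G.Adj u t) ∧
      (n : ℝ) ^ (1 - (i : ℝ) / 1000) ≤ T.card ∧
      (i : ℝ) * (Real.logb 2 n / 40) ≤ (Jind.card : ℝ) + Jclq.card := by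
  induction i with
  | zero =>
    refine Or.inr ⟨Finset.univ, ∅, ∅, ⟨?_, by simp⟩, ⟨?_, by simp⟩, ?_, by simp⟩
    · rw [Finset.coe_empty]; exact SimpleGraph.isClique_empty
    · rw [Finset.coe_empty]; exact SimpleGraph.isClique_empty
    · simp
  | succ i ih =>
    rcases ih (by omega) with h | ⟨T, Jind, Jclq, hJind, hJclq, hT, hpot⟩
    · exact Or.inl h
    have hi' : i ≤ 160 := by omega
    obtain ⟨h34, hsz⟩ := sizes hn hi' hT
    by_cases hgood : ∀ A ⊆ T, ∀ B ⊆ T, Disjoint A B →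
        (T.card : ℝ) ^ (1 - 1 / 2000 : ℝ) ≤ A.card → (T.card : ℝ) ^ (1 - 1 / 2000 : ℝ) ≤ B.card →
        δ₀ / 2 ≤ (G.edgeDensity A B : ℝ) ∧ δ₀ / 2 ≤ (Gᶜ.edgeDensity A B : ℝ)
    · exact Or.inl ⟨T, h34, hgood⟩
    push Not at hgood
    obtain ⟨A, hAT, B, hBT, hAB, hA, hB, hbad⟩ := hgood
    obtain ⟨hA2, -, -⟩ := hsz A hA
    obtain ⟨-, hBpos, hB3⟩ := hsz B hB
    right
    by_cases hsparse : (G.edgeDensity A B : ℝ) < δ₀ / 2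
    · obtain ⟨T', Jind', -, hJind', hJclq', hT'card, hpot'⟩ :=
        step G hδ₀ (hDRC G hG) hJind hJclq hAT hBT hAB hA2 hBpos hsparse
      refine ⟨T', Jind', Jclq, hJind', hJclq', hB3 T' hT'card, ?_⟩
      push_cast
      linarith
    · have hdense : (Gᶜ.edgeDensity A B : ℝ) < δ₀ / 2 := hbad (not_lt.1 hsparse)
      have hJclq_c : Gᶜᶜ.IsClique (Jclq : Set (Fin n)) ∧ ∀ u ∈ Jclq, ∀ t ∈ T, Gᶜᶜ.Adj u t := by
        rw [compl_compl]; exact hJclq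
      obtain ⟨T', Jclq', -, hJclq', hJind', hT'card, hpot'⟩ :=
        step Gᶜ hδ₀ (hDRC Gᶜ hGc) hJclq_c hJind hAT hBT hAB hA2 hBpos hdense
      rw [compl_compl] at hJclq'
      refine ⟨T', Jind, Jclq', hJind', hJclq', hB3 T' hT'card, ?_⟩
      push_cast
      linarith

/-- Termination: a state at level `161` is impossible, because `Jind` (a clique of `Gᶜ`) and `Jclq`
(a clique of `G`) both have fewer than `⌈log₂ n²⌉ ≤ 2 log₂ n + 1` vertices, while
`161 log₂ n / 40 > 4 log₂ n`. -/
private theorem no_state {n : ℕ} (G : SimpleGraph (Fin n)) (hn : 16 ≤ n) {Jind Jclq : Finset (Fin n)}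
    (hG : G.CliqueFree (Nat.clog 2 (n ^ 2))) (hGc : Gᶜ.CliqueFree (Nat.clog 2 (n ^ 2)))
    (hJind : Gᶜ.IsClique (Jind : Set (Fin n))) (hJclq : G.IsClique (Jclq : Set (Fin n)))
    (hpot : (161 : ℝ) * (Real.logb 2 n / 40) ≤ (Jind.card : ℝ) + Jclq.card) : False := by
  have h1 : Jind.card < Nat.clog 2 (n ^ 2) := card_lt_of_cliqueFree hGc hJind
  have h2 : Jclq.card < Nat.clog 2 (n ^ 2) := card_lt_of_cliqueFree hG hJclq
  have hn2 : 1 < n ^ 2 := by nlinarith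
  have hpow : 2 ^ (Nat.clog 2 (n ^ 2) - 1) < n ^ 2 := Nat.pow_pred_clog_lt_self (by norm_num) hn2
  have hnpos : (0 : ℝ) < n := by exact_mod_cast (by omega : 0 < n)
  have hlog : ((Nat.clog 2 (n ^ 2) - 1 : ℕ) : ℝ) < Real.logb 2 ((n : ℝ) ^ 2) := by
    rw [Real.lt_logb_iff_rpow_lt (by norm_num) (by positivity), Real.rpow_natCast]
    exact_mod_cast hpow
  rw [Real.logb_pow] at hlog
  have h3 : (Jind.card : ℝ) + Jclq.card ≤ 2 * ((Nat.clog 2 (n ^ 2) - 1 : ℕ) : ℝ) := by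
    have : Jind.card + Jclq.card ≤ 2 * (Nat.clog 2 (n ^ 2) - 1) := by omega
    exact_mod_cast this
  have hL : 0 ≤ Real.logb 2 (n : ℝ) :=
    Real.logb_nonneg (by norm_num) (by exact_mod_cast (by omega : 1 ≤ n))
  push_cast at hlog
  linarith

/-- **Prömel–Rödl core from the DRC step** (stub `stub_promelRodl` of the line
`box-dag-self-gadget-lifting`, crux stmt-PneNP-9816; Prömel–Rödl 1999 / LPRT arXiv:1303.3166 Lemma 11
at the Erdős threshold, disjoint-pair form): assuming the one-sided dependent-random-choice step
(for every `κ > 0` some `δ > 0` such that in every large `⌈log₂ n²⌉`-clique-free graph, every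
`√n`-size set pointwise `δ`-sparse towards `B` contains an independent set of size `≥ log₂ n / 40` with
`≥ |B| n^{-κ}` common non-neighbours in `B`), every graph `G` on `n ≥ n₀` vertices with
`G` and `Gᶜ` both `⌈log₂ n²⌉`-clique-free has a set `S`, `|S| ≥ n^{3/4}`, inside which `G` and `Gᶜ`
both have edge density `≥ δ` between any two disjoint subsets of size `≥ |S|^{1-β}`
(`β = 1/2000`). -/
theorem stub_promelRodl :
    (∀ κ : ℝ, 0 < κ → ∃ δ : ℝ, 0 < δ ∧ ∃ n₀ : ℕ, ∀ n ≥ n₀, ∀ (H : SimpleGraph (Fin n)) [DecidableRel H.Adj],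
      H.CliqueFree (Nat.clog 2 (n ^ 2)) →
      ∀ A B : Finset (Fin n), (n : ℝ) ^ ((1 : ℝ) / 2) ≤ A.card →
        (∀ v ∈ A, ((B.filter fun b => H.Adj v b).card : ℝ) ≤ δ * B.card) →
        ∃ J ⊆ A, Hᶜ.IsClique (J : Set (Fin n)) ∧ Real.logb 2 n / 40 ≤ J.card ∧
          (B.card : ℝ) * (n : ℝ) ^ (-κ) ≤ ((B.filter fun b => ∀ v ∈ J, ¬ H.Adj v b).card : ℝ)) →
    ∃ β δ : ℝ, 0 < β ∧ β < 1 ∧ 0 < δ ∧ ∃ n₀ : ℕ, ∀ n ≥ n₀, ∀ (G : SimpleGraph (Fin n)) [DecidableRel G.Adj],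
      G.CliqueFree (Nat.clog 2 (n ^ 2)) → Gᶜ.CliqueFree (Nat.clog 2 (n ^ 2)) →
      ∃ S : Finset (Fin n), (n : ℝ) ^ ((3 : ℝ) / 4) ≤ S.card ∧
        ∀ A ⊆ S, ∀ B ⊆ S, Disjoint A B →
          (S.card : ℝ) ^ (1 - β) ≤ A.card → (S.card : ℝ) ^ (1 - β) ≤ B.card →
          δ ≤ (G.edgeDensity A B : ℝ) ∧ δ ≤ (Gᶜ.edgeDensity A B : ℝ) := by
  intro h
  obtain ⟨δ₀, hδ₀, n₁, hDRC⟩ := h (1 / 2000) (by norm_num)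
  refine ⟨1 / 2000, δ₀ / 2, by norm_num, by norm_num, by linarith, max n₁ 16, ?_⟩
  intro n hn G _ hG hGc
  have hn₁ : n₁ ≤ n := le_trans (le_max_left _ _) hn
  have hn16 : 16 ≤ n := le_trans (le_max_right _ _) hn
  rcases iterate G hδ₀ hn16 (hDRC n hn₁) hG hGc 161 le_rfl with h | ⟨T, Jind, Jclq, hJind, hJclq, -, hpot⟩
  · exact h
  · exact (no_state G hn16 hG hGc hJind.1 hJclq.1 (by exact_mod_cast hpot)).elim

end Summit.PneNP.PneNP.Theorems.RamseyUncertifiableResolutionUncertainty
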